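import Summits.BirchSwinnertonDyer.BirchSwinnertonDyer.Theorems.PrintCf2RubinValueTwoColemanCoinvariantCharTraceAugmentation
import HarnessLib

/-!
# Brick (c) at `p = 2`, local `χ`-part: THE AUGMENTATION CONTAINMENT WITH AN EXPONENT — if the translates `(σ̃β_c)·(β_c⁻¹)^N` of the generators of `C₁`
# lie in `C₂`, then `(t_{χ(σ̃)}·C g_σ̃ − N)·φ_ε(Col_Σ C₁) ⊆ φ_ε(Col_Σ C₂)` (de Shalit II §2.4 (ii) / §4.12: the product rule `(σ_𝔠 − N𝔠)·e(𝔞) = (σ_𝔞 − N𝔞)·e(𝔠)`)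

Cell `bsd-print-cf2`, width seat `bsd-line-cf2c-w7` g26, route C `PrintCf2RubinValueTwo`, crux of record stmt-BirchSwinnertonDyer-24033
`TwoVariableMainConjAtSplitTwoQuad` (23720 nominal), BRICK §4(c), item D4χ (`BrickCD4Chi.BrickCD4ChiClosureComparison`); `--supports` the crux as a helper.
Sequel of `PrintCf2RubinValueTwoColemanCoinvariantCharTraceAugmentation.lean` (p820722, the case `N = 1`).  The (β) product-rule trick of the seat's memo
(liftable `𝔞` outside Robert's index convention `(𝔞, 6𝔣) = 1`): `(σ̃_𝔠·y(𝔞))·(y(𝔞)⁻¹)^{N𝔠} = (σ̃_𝔞·y(𝔠))·(y(𝔠)⁻¹)^{N𝔞}` lies in the good sub-family for EVERY generator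
`y(𝔞)`, so `(ρ(σ̃_𝔠) − N𝔠)·φ_ε(Col_Σ A_χ) ⊆ φ_ε(Col_Σ A_χ^{(𝔟)})` — THIS file is the Λ-side of that step, for general closed subgroups `C₁, C₂ ⊆ 𝒰¹_∞`:

* `baseNormCoherent_pow`, `pow_mem_principalCoherentFamilies`, ★ `colemanImage_pow` (`Col(β^N) = N·Col β`);
* ★ `colemanImage_galAct_mul_inv_pow` (`Col((σ̃β)·(β⁻¹)^N) = 𝒯_σ̃ Col β − N·Col β`), `map_indexTraceₗ_colemanImage_galAct_mul_inv_pow`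
  (`φ_ε(Σ Col((σ̃β)(β⁻¹)^N)) = (t_{χ(σ̃)}·C g − N)·φ_ε(Σ Col β)`);
* ★★ `smul_mem_map_colemanImageTrace_of_galAct_mul_inv_pow_mem` — THE EXPONENT-`N` AUGMENTATION CONTAINMENT.
THEOREMS ONLY (0 sorry, no new definitions, no named-fact hypotheses).  BSD is not proved by any of this; nothing here closes 24033.

## References
* [deShalit1987] E. de Shalit, *Iwasawa theory of elliptic curves with complex multiplication* (1987), I §3.1, §3.4 Lemma (i)–(ii), §3.8 (17); II §2.4 (ii),
  §4.12 (29)–(32); III §1.3–1.4 (5), Lemma 1.10 (17).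
* [Washington1997] L. C. Washington, *Introduction to Cyclotomic Fields* (1997), §13.2.
* [BourbakiGT1] N. Bourbaki, *General Topology*, Ch. I §2.1.
-/

noncomputable section

set_option linter.dupNamespace false
set_option autoImplicit false

open Filter Topology
open scoped PowerSeries.WithPiTopology

namespace Summit.BirchSwinnertonDyer.BirchSwinnertonDyer.Theorems.PrintCf2.ColemanCoinvariantTraceAugmentation

open Literature.NumberTheory.GaloisRepresentations Literature.NumberTheory.GaloisRepresentations.IsNonarchimedeanLocalField
  Literature.NumberTheory.GaloisRepresentations.LubinTate ValuativeRel Field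
open Literature.NumberTheory.EllipticCurves
open Summit.BirchSwinnertonDyer.BirchSwinnertonDyer.Theorems.PrintCf2.ColemanImage
open Summit.BirchSwinnertonDyer.BirchSwinnertonDyer.Theorems.PrintCf2.ColemanCoinvariantTrace

variable {F : Type} [Field F] [ValuativeRel F] [TopologicalSpace F] [IsNonarchimedeanLocalField F]

attribute [local instance] ltNormUniformSpace ltNormIsUniformAddGroup rk1 nF nE fintypeResidueField
attribute [local instance] RelNormCoherentUnits.instCommMonoid
attribute [local instance] isAdicComplete_maximalIdeal_powerSeries_integer

variable {p : ℕ} [hp : Fact p.Prime] {d : ℕ} (hd : d.Coprime p)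
variable {π : 𝒪[F]} (hπ : (valuation F).IsUniformizer (π : F))
variable (E : ℕ → IntermediateField F (AlgebraicClosure F)) [∀ m, FiniteDimensional F (E m)] [∀ m, Normal F (E m)]
  [∀ m, IsGalois F (E m)] (hmono : Monotone E) (hE : ∀ m, E m ≤ maxUnramified F) (hdeg : ∀ m, Module.finrank F (E m) = d * p ^ m)
  {σ₀ : absoluteGaloisGroup F} (hσ₀ : IsAbsArithFrob σ₀) (hq : residueFieldCard F = 2)
variable (u : (LTCoeff F)ˣ) (hu : LTCoeff.of F π = residueFieldCard F * u) (γ w : 𝒪[F]ˣ) (hγ : (γ : 𝒪[F]) = 1 + π ^ 2 * w)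
variable [IsAdicComplete (Ideal.span {intBase F (LTCoeff.of F π)}) (PowerSeries 𝒪[F])] [NeZero d]
variable {θ : ∀ m, unitBall (E m)} (hθ : ∀ m, IsIntegralNormalGen (E m) (θ m))
  (hcoh : ∀ m, unitBallTrace (hmono (Nat.le_succ m)) (θ (m + 1)) = θ m)
variable [IsAdicComplete (Ideal.span {(p : 𝒪[F])}) 𝒪[F]]
  (hN : DenseRange (Nat.cast : ℕ → 𝒪[F]))
  (ε : PowerSeries (PowerSeries 𝒪[F]))

/-! ## §1. Powers: `Col(β^N) = N·Col β` -/

omit [∀ m, Normal F (E m)] [IsAdicComplete (Ideal.span {intBase F (LTCoeff.of F π)}) (PowerSeries 𝒪[F])] in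
/-- Powers of baseNorm-coherent families are baseNorm-coherent. [cite: deShalit1987, Ch. I §3.8 (16)] -/
theorem baseNormCoherent_pow {β : ∀ m, RelNormCoherentUnits hπ (E m)} (hβ : ∀ m, (β (m + 1)).baseNorm hπ (hmono (Nat.le_succ m)) = β m) (N : ℕ) :
    ∀ m, ((β ^ N) (m + 1)).baseNorm hπ (hmono (Nat.le_succ m)) = (β ^ N) m := by
  induction N with
  | zero => intro m; simp only [pow_zero, Pi.one_apply]; exact baseNormCoherent_one hπ E hmono m
  | succ n ih =>
    intro m
    simp only [Pi.pow_apply, pow_succ]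
    have h := baseNormCoherent_mul hπ E hmono (β := β ^ n) (β' := β) ih hβ m
    simp only [Pi.pow_apply] at h
    exact h

omit [∀ m, Normal F (E m)] [IsAdicComplete (Ideal.span {intBase F (LTCoeff.of F π)}) (PowerSeries 𝒪[F])] in
/-- Powers of principal coherent families are principal coherent (`𝒰¹_∞` is a group). [cite: deShalit1987, Ch. III §1.4] -/
theorem pow_mem_principalCoherentFamilies {β : ∀ m, RelNormCoherentUnits hπ (E m)} (hβ : β ∈ principalCoherentFamilies hπ E hmono) (N : ℕ) :
    β ^ N ∈ principalCoherentFamilies hπ E hmono := by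
  induction N with
  | zero => rw [pow_zero]; exact one_mem_principalCoherentFamilies hπ E hmono
  | succ n ih =>
    have h := mul_mem_principalCoherentFamilies hπ E hmono ih hβ
    have e : (fun m => ((β ^ n) m).mul (β m)) = β ^ (n + 1) := funext fun m => by simp only [Pi.pow_apply, pow_succ]; rfl
    rwa [e] at h

omit [IsAdicComplete (Ideal.span {intBase F (LTCoeff.of F π)}) (PowerSeries 𝒪[F])] in
include hdeg in
/-- ★ **`Col(β^N) = N·Col β`** (`Col` is a homomorphism: `colemanImage_mul`, `colemanImage_one`). [cite: deShalit1987, Ch. I §3.4 Lemma (i)] -/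
theorem colemanImage_pow {β : ∀ m, RelNormCoherentUnits hπ (E m)} (hβ : ∀ m, (β (m + 1)).baseNorm hπ (hmono (Nat.le_succ m)) = β m) (N : ℕ)
    (h : ∀ m, ((β ^ N) (m + 1)).baseNorm hπ (hmono (Nat.le_succ m)) = (β ^ N) m) :
    colemanImage hd hπ E hmono hE hdeg hσ₀ hq u hu γ hθ hcoh (β := β ^ N) h = N • colemanImage hd hπ E hmono hE hdeg hσ₀ hq u hu γ hθ hcoh hβ := by
  induction N with
  | zero =>
    rw [zero_smul, colemanImage_congr hd hπ E hmono hE hdeg hσ₀ hq u hu γ hθ hcoh h (baseNormCoherent_one hπ E hmono) (funext fun m => by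
      rw [Pi.pow_apply, pow_zero])]
    exact colemanImage_one hd hπ E hmono hE hdeg hσ₀ hq u hu γ hθ hcoh
  | succ n ih =>
    have hn := baseNormCoherent_pow hπ E hmono hβ n
    have hprod : ∀ m, (((β ^ n) (m + 1)).mul (β (m + 1))).baseNorm hπ (hmono (Nat.le_succ m)) = ((β ^ n) m).mul (β m) :=
      baseNormCoherent_mul hπ E hmono hn hβ
    rw [colemanImage_congr hd hπ E hmono hE hdeg hσ₀ hq u hu γ hθ hcoh h hprod (funext fun m => by simp only [Pi.pow_apply, pow_succ]; rfl),
      colemanImage_mul hd hπ E hmono hE hdeg hσ₀ hq u hu γ hθ hcoh hn hβ hprod, ih hn, add_smul, one_smul]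

/-! ## §2. `φ_ε(Σ Col((σ̃β)(β⁻¹)^N)) = (t_{χ(σ̃)}·C g − N)·φ_ε(Σ Col β)` -/

include hdeg in
/-- ★ **`Col((σ̃β)·(β⁻¹)^N) = 𝒯_σ̃(Col β) − N·Col β`** for a principal coherent `β` and an Amice pair `(g, s)` of `σ̃|_{E_∞}`.
[cite: deShalit1987, I §3.4 Lemma (i)–(ii), §3.8 (17); II §2.4 (ii); III §1.3] -/
theorem colemanImage_galAct_mul_inv_pow {β : ∀ m, RelNormCoherentUnits hπ (E m)} (hβ : β ∈ principalCoherentFamilies hπ E hmono)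
    (σ : absoluteGaloisGroup F) {g : PowerSeries 𝒪[F]} {s : ZMod d}
    (hg : ∀ m, ∃ a : ℕ, (∀ x : E m, σ • (x : AlgebraicClosure F) = (σ₀ ^ a) • (x : AlgebraicClosure F)) ∧
      ((1 + PowerSeries.X : PowerSeries 𝒪[F]) ^ p ^ m - 1) ∣ g - (1 + PowerSeries.X) ^ a ∧ (a : ZMod d) = s) (N : ℕ)
    (h : ∀ m, (((β (m + 1)).galAct σ).mul (((fun m => (β m).inv hπ (E m)) ^ N) (m + 1))).baseNorm hπ (hmono (Nat.le_succ m)) =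
      ((β m).galAct σ).mul (((fun m => (β m).inv hπ (E m)) ^ N) m)) :
    colemanImage hd hπ E hmono hE hdeg hσ₀ hq u hu γ hθ hcoh (β := fun m => ((β m).galAct σ).mul (((fun m => (β m).inv hπ (E m)) ^ N) m)) h =
      galOpₗ hπ hq u hu γ (lubinTateChar hπ σ) g s (colemanImage hd hπ E hmono hE hdeg hσ₀ hq u hu γ hθ hcoh hβ.1) -
        N • colemanImage hd hπ E hmono hE hdeg hσ₀ hq u hu γ hθ hcoh hβ.1 := by
  have hgal := galAct_mem_principalCoherentFamilies hπ E hmono hβ σ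
  have hinv := inv_mem_principalCoherentFamilies hπ E hmono hβ
  have hinvN := baseNormCoherent_pow hπ E hmono (β := fun m => (β m).inv hπ (E m)) hinv.1 N
  rw [colemanImage_mul hd hπ E hmono hE hdeg hσ₀ hq u hu γ hθ hcoh (β := fun m => (β m).galAct σ) (β' := (fun m => (β m).inv hπ (E m)) ^ N) hgal.1 hinvN h,
    colemanImage_galAct hd hπ E hmono hE hdeg hσ₀ hq u hu γ hθ hcoh hβ.1 σ hg,
    colemanImage_pow hd hπ E hmono hE hdeg hσ₀ hq u hu γ hθ hcoh hinv.1 N hinvN, colemanImage_inv hd hπ E hmono hE hdeg hσ₀ hq u hu γ hθ hcoh hβ,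
    smul_neg, sub_eq_add_neg]

include hdeg in
/-- ★ **`φ_ε(Σ Col((σ̃β)(β⁻¹)^N)) = (t_{χ(σ̃)}·C g_σ̃ − N)·φ_ε(Σ Col β)`**. [cite: deShalit1987, I §3.1, §3.4 Lemma (ii); II §2.4 (ii), §4.12 (29); III §1.4 (5)] -/
theorem map_indexTraceₗ_colemanImage_galAct_mul_inv_pow (hε : ε * ε = 1) {β : ∀ m, RelNormCoherentUnits hπ (E m)}
    (hβ : β ∈ principalCoherentFamilies hπ E hmono) (σ : absoluteGaloisGroup F) {g : PowerSeries 𝒪[F]} {s : ZMod d}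
    (hg : ∀ m, ∃ a : ℕ, (∀ x : E m, σ • (x : AlgebraicClosure F) = (σ₀ ^ a) • (x : AlgebraicClosure F)) ∧
      ((1 + PowerSeries.X : PowerSeries 𝒪[F]) ^ p ^ m - 1) ∣ g - (1 + PowerSeries.X) ^ a ∧ (a : ZMod d) = s) (N : ℕ)
    (h : ∀ m, (((β (m + 1)).galAct σ).mul (((fun m => (β m).inv hπ (E m)) ^ N) (m + 1))).baseNorm hπ (hmono (Nat.le_succ m)) =
      ((β m).galAct σ).mul (((fun m => (β m).inv hπ (E m)) ^ N) m)) :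
    colemanDeltaCoinvFun hπ hq (intBase F) u hu γ (eq_zero_of_C_pi_mul_eq_zero_integer hπ) w hγ ε
        (indexTraceₗ hπ hq u hu γ
          (colemanImage hd hπ E hmono hE hdeg hσ₀ hq u hu γ hθ hcoh (β := fun m => ((β m).galAct σ).mul (((fun m => (β m).inv hπ (E m)) ^ N) m)) h)) =
      (colemanDeltaCoinvFun hπ hq (intBase F) u hu γ (eq_zero_of_C_pi_mul_eq_zero_integer hπ) w hγ ε
          (unitTwistₗ hπ hq (intBase F) u hu γ (lubinTateChar hπ σ) (TActModule.ofPS _ _ 1)) * PowerSeries.C g - N) *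
        colemanDeltaCoinvFun hπ hq (intBase F) u hu γ (eq_zero_of_C_pi_mul_eq_zero_integer hπ) w hγ ε
          (indexTraceₗ hπ hq u hu γ (colemanImage hd hπ E hmono hE hdeg hσ₀ hq u hu γ hθ hcoh hβ.1)) := by
  rw [colemanImage_galAct_mul_inv_pow hd hπ E hmono hE hdeg hσ₀ hq u hu γ hθ hcoh hβ σ hg N h, map_sub, map_sub,
    map_indexTraceₗ_galOpₗ hπ hq u hu γ w hγ ε hε, map_nsmul, map_nsmul, sub_mul, nsmul_eq_mul]

/-! ## §3. From the generators to the ideal: `(t_{χ(σ̃)}·C g_σ̃ − N)·I₁ ⊆ I₂` -/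

variable
  (C₁ : Set (∀ m, RelNormCoherentUnits hπ (E m))) (hC₁ : IsClosed C₁) (hC₁sub : C₁ ⊆ principalCoherentFamilies hπ E hmono)
  (h1₁ : (fun m => (RelNormCoherentUnits.one : RelNormCoherentUnits hπ (E m))) ∈ C₁)
  (hmul₁ : ∀ β ∈ C₁, ∀ β' ∈ C₁, (fun m => (β m).mul (β' m)) ∈ C₁) (hinv₁ : ∀ β ∈ C₁, (fun m => (β m).inv hπ (E m)) ∈ C₁)
  (hgal₁ : ∀ σ : absoluteGaloisGroup F, ∀ β ∈ C₁, (fun m => (β m).galAct σ) ∈ C₁)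
  (C₂ : Set (∀ m, RelNormCoherentUnits hπ (E m))) (hC₂ : IsClosed C₂) (hC₂sub : C₂ ⊆ principalCoherentFamilies hπ E hmono)
  (h1₂ : (fun m => (RelNormCoherentUnits.one : RelNormCoherentUnits hπ (E m))) ∈ C₂)
  (hmul₂ : ∀ β ∈ C₂, ∀ β' ∈ C₂, (fun m => (β m).mul (β' m)) ∈ C₂) (hinv₂ : ∀ β ∈ C₂, (fun m => (β m).inv hπ (E m)) ∈ C₂)
  (hgal₂ : ∀ σ : absoluteGaloisGroup F, ∀ β ∈ C₂, (fun m => (β m).galAct σ) ∈ C₂)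
  {I : Type*} (β : I → ∀ m, RelNormCoherentUnits hπ (E m)) (hβC₁ : ∀ c, β c ∈ C₁)
  (hC₁gen : C₁ ⊆ closure (Submonoid.closure (Set.range β ∪ Set.range fun c => fun m => ((β c) m).inv hπ (E m)) : Set _))

include hdeg hE hmono h1₁ hmul₁ hinv₁ hβC₁ hC₁gen in
/-- ★★ **THE EXPONENT-`N` AUGMENTATION CONTAINMENT.**  `C₁ ⊆ closure ⟨β_c^{±1}⟩` with `β_c ∈ C₁`, `C₂` a closed `Γ_F`-stable subgroup of `𝒰¹_∞`, `σ̃ ∈ Γ_F` with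
Amice pair `(g, s)`, `N : ℕ`; if `(σ̃β_c)·(β_c⁻¹)^N ∈ C₂` for every `c`, then **`(t_{χ(σ̃)}·C g − N)·a ∈ φ_ε(Col_Σ C₂)` for every `a ∈ φ_ε(Col_Σ C₁)`** — the Λ-side of the
product-rule trick `(σ_𝔠 − N𝔠)·e(𝔞) = (σ_𝔞 − N𝔞)·e(𝔠)`. [cite: deShalit1987, II §2.4 (ii), §4.12 (29)–(32); III §1.4 (5), Lemma 1.10] [cite: Washington1997, §13.2]
[cite: BourbakiGT1, Ch. I §2.1 Th. 1] -/
theorem smul_mem_map_colemanImageTrace_of_galAct_mul_inv_pow_mem (hε : ε * ε = 1) (σ : absoluteGaloisGroup F) {g : PowerSeries 𝒪[F]} {s : ZMod d}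
    (hg : ∀ m, ∃ a : ℕ, (∀ x : E m, σ • (x : AlgebraicClosure F) = (σ₀ ^ a) • (x : AlgebraicClosure F)) ∧
      ((1 + PowerSeries.X : PowerSeries 𝒪[F]) ^ p ^ m - 1) ∣ g - (1 + PowerSeries.X) ^ a ∧ (a : ZMod d) = s) (N : ℕ)
    (hmem : ∀ c, (fun m => ((β c m).galAct σ).mul (((fun m => (β c m).inv hπ (E m)) ^ N) m)) ∈ C₂) :
    ∀ a ∈ (colemanImageTrace hd hπ E hmono hE hdeg hσ₀ hq u hu γ hθ hcoh hN C₁ hC₁ hC₁sub h1₁ hmul₁ hinv₁ hgal₁).map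
        (colemanDeltaCoinvFun hπ hq (intBase F) u hu γ (eq_zero_of_C_pi_mul_eq_zero_integer hπ) w hγ ε),
      (colemanDeltaCoinvFun hπ hq (intBase F) u hu γ (eq_zero_of_C_pi_mul_eq_zero_integer hπ) w hγ ε
          (unitTwistₗ hπ hq (intBase F) u hu γ (lubinTateChar hπ σ) (TActModule.ofPS _ _ 1)) * PowerSeries.C g - N) • a ∈
      (colemanImageTrace hd hπ E hmono hE hdeg hσ₀ hq u hu γ hθ hcoh hN C₂ hC₂ hC₂sub h1₂ hmul₂ hinv₂ hgal₂).map
        (colemanDeltaCoinvFun hπ hq (intBase F) u hu γ (eq_zero_of_C_pi_mul_eq_zero_integer hπ) w hγ ε) := by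
  haveI : CompactSpace (PowerSeries 𝒪[F]) := PowerSeries.WithPiTopology.compactSpace _
  haveI : CompactSpace (PowerSeries (PowerSeries 𝒪[F])) := PowerSeries.WithPiTopology.compactSpace _
  set f : PowerSeries (PowerSeries 𝒪[F]) :=
    colemanDeltaCoinvFun hπ hq (intBase F) u hu γ (eq_zero_of_C_pi_mul_eq_zero_integer hπ) w hγ ε
        (unitTwistₗ hπ hq (intBase F) u hu γ (lubinTateChar hπ σ) (TActModule.ofPS _ _ 1)) * PowerSeries.C g - N with hf
  -- the continuous linear map `y ↦ f · φ_ε(y)`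
  let φ' : ColemanCoordModule hπ hq (intBase F) u hu γ →ₗ[PowerSeries (PowerSeries 𝒪[F])] PowerSeries (PowerSeries 𝒪[F]) :=
    f • colemanDeltaCoinvFun hπ hq (intBase F) u hu γ (eq_zero_of_C_pi_mul_eq_zero_integer hπ) w hγ ε
  have hφ' : Continuous φ' := (continuous_const.mul (continuous_colemanDeltaCoinvFun_intBase hπ hq u hu γ w hγ ε) :)
  -- generators land in `I₂`
  have hgenmem : ∀ c, φ' (indexTraceₗ hπ hq u hu γ (colemanImage hd hπ E hmono hE hdeg hσ₀ hq u hu γ hθ hcoh (hC₁sub (hβC₁ c)).1)) ∈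
      (colemanImageTrace hd hπ E hmono hE hdeg hσ₀ hq u hu γ hθ hcoh hN C₂ hC₂ hC₂sub h1₂ hmul₂ hinv₂ hgal₂).map
        (colemanDeltaCoinvFun hπ hq (intBase F) u hu γ (eq_zero_of_C_pi_mul_eq_zero_integer hπ) w hγ ε) := by
    intro c
    have hpcf : (fun m => ((β c m).galAct σ).mul (((fun m => (β c m).inv hπ (E m)) ^ N) m)) ∈ principalCoherentFamilies hπ E hmono :=
      mul_mem_principalCoherentFamilies hπ E hmono (galAct_mem_principalCoherentFamilies hπ E hmono (hC₁sub (hβC₁ c)) σ)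
        (pow_mem_principalCoherentFamilies hπ E hmono (inv_mem_principalCoherentFamilies hπ E hmono (hC₁sub (hβC₁ c))) N)
    have e := map_indexTraceₗ_colemanImage_galAct_mul_inv_pow hd hπ E hmono hE hdeg hσ₀ hq u hu γ w hγ hθ hcoh ε hε (hC₁sub (hβC₁ c)) σ hg N hpcf.1
    change f * _ ∈ _
    rw [← e]
    exact Submodule.mem_map_of_mem
      (indexTraceₗ_colemanImage_mem_colemanImageTrace hd hπ E hmono hE hdeg hσ₀ hq u hu γ hθ hcoh hpcf (hmem c))
  have hle : (colemanImageTrace hd hπ E hmono hE hdeg hσ₀ hq u hu γ hθ hcoh hN C₁ hC₁ hC₁sub h1₁ hmul₁ hinv₁ hgal₁).map φ' ≤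
      (colemanImageTrace hd hπ E hmono hE hdeg hσ₀ hq u hu γ hθ hcoh hN C₂ hC₂ hC₂sub h1₂ hmul₂ hinv₂ hgal₂).map
        (colemanDeltaCoinvFun hπ hq (intBase F) u hu γ (eq_zero_of_C_pi_mul_eq_zero_integer hπ) w hγ ε) :=
    Submodule.map_le_of_subset_closure φ' hφ'
      (AddSubgroup.mapsTo_closure_range_of_forall_mem φ'
        (fun c => indexTraceₗ hπ hq u hu γ (colemanImage hd hπ E hmono hE hdeg hσ₀ hq u hu γ hθ hcoh (hC₁sub (hβC₁ c)).1)) _ hgenmem)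
      (Ideal.isClosed_of_isNoetherianRing _) _
      (colemanImageTrace_subset_closure hd hπ E hmono hE hdeg hσ₀ hq u hu γ hθ hcoh hN C₁ hC₁ hC₁sub h1₁ hmul₁ hinv₁ hgal₁ β hβC₁ hC₁gen)
  rintro a ⟨y, hy, rfl⟩
  exact hle (Submodule.mem_map_of_mem (f := φ') hy)

end Summit.BirchSwinnertonDyer.BirchSwinnertonDyer.Theorems.PrintCf2.ColemanCoinvariantTraceAugmentation

end
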